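import Summits.QuantumFields.BalabanUV.T4Continuum.Support.NE7HapeOfLocalChart
import HarnessLib

/-!
# NE7TorusRoadLine — THE SCALAR LINE OF `hape_of_localChart` FROM TWO EXPLICIT BUDGET INEQUALITIES: after multiplying F263's line by `M²`, every term of the
# closed-form constants of F278 is bounded by `(coefficient)·r`, `(coefficient)·t` (`t = r + 4(e^β − 1) + ε ≤ T = δ + 4(e^β − 1) + ε`) or `(coefficient)·4(e^β − 1)`,
# uniformly in `k` (`M = L^{k+1} ≥ 1`) — `rho_currency` for the two EXP densities, `x = Ma₀ ≤ C₀t`, `M²a₁ ≤ C₁t`; so the line holds as soon as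
# `A_r + A_t ≤ θ` and `A_t·(4(e^β − 1) + ε) + A_β·4(e^β − 1) ≤ c₀` with `A_r, A_t, A_β` explicit in `(K, c, ℓ, ε, δ, β, C₀, C₁, d, L, card n)`

Cell `pub-balaban`, rung (B)+1 sub-cell t4, lineage `b2b-balaban-t4-ne7-p1` (CRUX PROVER NE7 #1 = OWNER of row NE7), generation 90; memo
`t4/b2b-balaban-t4-ne7-p1-g90/DEFECT-FAR.md` §6(a).  File F280 (over F279 `NE7HapeOfLocalChart` (the shape of `hline`) and F48b `NE7ExpansionRemainderFlat.rho_currency`).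

WHY.  F279 `hape_of_localChart` left two hypotheses besides the class smallness: the chart (N1)-weak and the scalar line `hline` (∀ k r a₀ a₁).  THIS FILE discharges
`hline` from two closed-form budget inequalities, which a consumer checks once for its choice of `(ℓ, ε, δ, β, c₀, θ)`: `A_r` collects the terms linear in `r` (the
criticality pairing `r·(Ma₀)·C_cK_d` and the far shell `r·C_c·e^{−cℓ}`), `A_t` the quadratic ones (EXP densities, coarse curvature, `28x²`) and the discounted linear ones
(`e^{−cℓ}·4#Plane(C₀ + C₁)`, the split's `E` behind `e^{−κ′ℓ∕2}·poly(ℓ)`), `A_β` the datum terms (`ĝ₀ ∋ β′`).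
WHAT ([folklore] real bookkeeping; 0 def, 0 sorry).
§1 generic-letter lemmas: `line_scaling` (the line ⇐ its `M²`-multiple), `R_poly_le` (`R(C₀t, Ct) ≤ t·R₁(T)`), `Q_le` (the coarse-curvature quadratic `≤ Q_c·t`),
   `rho_scaled` (`M³·ρ(a₀,α₁) ≤ #Plane·R(αh, αh1)`, `rho_currency`).
§2 **`line_of_budget`** — `A_r + A_t ≤ θ`, `A_t(4(e^β−1) + ε) + A_β·4(e^β−1) ≤ c₀` (plus signs and `C₀T ≤ 1`, `thetaLoc·ε < 1`) ⇒ the `hline` binder of F279 VERBATIM.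
HONEST FRAMING (page 1): inequalities among real numbers; nothing of Bałaban's asserted; NOT (APE), NOT ONE-STEP, NOT NE7; spine 0∕9; finite T⁴ rung (B)+1 — NOT infinite
volume, NOT mass gap, NOT `BetaPertH`, NOT Clay.  Continuum YM on T⁴ ⇐ BetaPertH ∧ nine spine estimates (0/9 proved); BetaPertH ⇐ (D1) ∧ (D4) ∧ CAP+tail; G-an2-4 gates
asym, D1 and NE2/3/4.
-/

set_option autoImplicit false

open scoped BigOperators Matrix.Norms.L2Operator
open NormedSpace Finset Set

namespace Summit.QuantumFields.BalabanUV.T4Continuum.NE7TorusRoadLine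

open Literature.MathematicalPhysics.QuantumFieldTheory.Balaban1983to89
open B7Prop1Explicit B7Prop2Explicit
open BlockAverageVaryHolo (nbRad)
open BlockAverageVaryDisc (rho0 rho0_pos)
open B4Sect5Proof (latticeConst latticeConst_nonneg)
open B5Hk163Strip (kappa163 kappa163_pos)
open B5Hk163TorusHolderDecay (CdecD CdecD_nonneg)
open NE3RightInverseSolveLetters (thetaLoc)
open NE3HatInvCurlLetters (curl1C curl1C_nonneg)
open NE7ExpansionRemainderFlat (rho_currency)

noncomputable section

variable {d : ℕ} {n : Type*} [Fintype n] [DecidableEq n]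

/-! ## §1 Generic-letter lemmas -/

omit [Fintype n] [DecidableEq n] in
/-- The line follows from its `M²`-multiple. [folklore] -/
theorem line_scaling {K M e cn Cg G Cd D W a₀ Z₁ Z₂ c₀ θ r : ℝ} (hM : 0 < M)
    (h : K * M ^ 3 * (Z₁ + e * Z₂) + cn * (Cg * G + 2 * (Cd * (D * W))) + 28 * (M * a₀) ^ 2 ≤ c₀ + θ * r) :
    K * M * (Z₁ + e * Z₂) + cn * (Cg / M * (G / M) + M⁻¹ * (2 * (Cd * (D / M * W)))) + 28 * a₀ ^ 2 ≤ (c₀ + θ * r) / M ^ 2 := by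
  rw [le_div_iff₀ (by positivity)]
  have e1 : (K * M * (Z₁ + e * Z₂) + cn * (Cg / M * (G / M) + M⁻¹ * (2 * (Cd * (D / M * W)))) + 28 * a₀ ^ 2) * M ^ 2
      = K * M ^ 3 * (Z₁ + e * Z₂) + cn * (Cg * G + 2 * (Cd * (D * W))) + 28 * (M * a₀) ^ 2 := by
    field_simp
  rw [e1]
  exact h

omit [Fintype n] [DecidableEq n] in
/-- `R(C₀t, Ct) ≤ t·R₁(T)` for `0 ≤ t ≤ T`, `R(u,v) = 144uv + 5440u³ + 8v² + 304vu² + 2688u⁴` (`rho_currency`'s polynomial). [folklore] -/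
theorem R_poly_le {t T C₀ C : ℝ} (ht0 : 0 ≤ t) (htT : t ≤ T) (hC₀ : 0 ≤ C₀) (hC : 0 ≤ C) :
    144 * (C₀ * t * (C * t)) + 5440 * (C₀ * t) ^ 3 + 8 * (C * t * (C * t)) + 304 * (C * t * (C₀ * t) ^ 2) + 2688 * (C₀ * t) ^ 4
      ≤ t * (T * (144 * C₀ * C + 8 * C ^ 2) + T ^ 2 * (5440 * C₀ ^ 3 + 304 * C * C₀ ^ 2) + T ^ 3 * (2688 * C₀ ^ 4)) := by
  have h2 : t ^ 2 ≤ t * T := by nlinarith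
  have hT0 : 0 ≤ T := ht0.trans htT
  have h3 : t ^ 3 ≤ t * T ^ 2 := by nlinarith [mul_le_mul h2 htT ht0 (by positivity)]
  have h4 : t ^ 4 ≤ t * T ^ 3 := by
    have : t ^ 3 ≤ T ^ 3 := pow_le_pow_left₀ ht0 htT 3
    nlinarith
  have e1 : 144 * (C₀ * t * (C * t)) + 5440 * (C₀ * t) ^ 3 + 8 * (C * t * (C * t)) + 304 * (C * t * (C₀ * t) ^ 2) + 2688 * (C₀ * t) ^ 4
      = t ^ 2 * (144 * C₀ * C + 8 * C ^ 2) + t ^ 3 * (5440 * C₀ ^ 3 + 304 * C * C₀ ^ 2) + t ^ 4 * (2688 * C₀ ^ 4) := by ring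
  rw [e1]
  have k1 : 0 ≤ 144 * C₀ * C + 8 * C ^ 2 := by positivity
  have k2 : 0 ≤ 5440 * C₀ ^ 3 + 304 * C * C₀ ^ 2 := by positivity
  have k3 : 0 ≤ 2688 * C₀ ^ 4 := by positivity
  nlinarith [mul_le_mul_of_nonneg_right h2 k1, mul_le_mul_of_nonneg_right h3 k2, mul_le_mul_of_nonneg_right h4 k3]

omit [Fintype n] [DecidableEq n] in
/-- The coarse-curvature quadratic: `28(K₃x + K₄x²)² + 4K₄x² ≤ (28(K₃ + K₄C₀T)² + 4K₄)·C₀²T·t` for `0 ≤ x ≤ C₀t`, `0 ≤ t ≤ T`, `K₃, K₄, C₀ ≥ 0`. [folklore] -/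
theorem Q_le {x t T C₀ K₃ K₄ : ℝ} (hx0 : 0 ≤ x) (hx : x ≤ C₀ * t) (ht0 : 0 ≤ t) (htT : t ≤ T) (hC₀ : 0 ≤ C₀) (hK₃ : 0 ≤ K₃) (hK₄ : 0 ≤ K₄) :
    28 * (K₃ * x + K₄ * x ^ 2) ^ 2 + 4 * (K₄ * x ^ 2) ≤ (28 * (K₃ + K₄ * (C₀ * T)) ^ 2 + 4 * K₄) * (C₀ ^ 2 * T) * t := by
  have hxT : x ≤ C₀ * T := hx.trans (mul_le_mul_of_nonneg_left htT hC₀)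
  have hx2 : x ^ 2 ≤ C₀ ^ 2 * T * t := by
    have h1 : x ^ 2 ≤ (C₀ * t) ^ 2 := pow_le_pow_left₀ hx0 hx 2
    nlinarith [mul_le_mul_of_nonneg_left htT (by positivity : 0 ≤ C₀ ^ 2 * t)]
  have hin : K₃ + K₄ * x ≤ K₃ + K₄ * (C₀ * T) := by nlinarith
  have hin0 : 0 ≤ K₃ + K₄ * x := by positivity
  have hsq : (K₃ + K₄ * x) ^ 2 ≤ (K₃ + K₄ * (C₀ * T)) ^ 2 := pow_le_pow_left₀ hin0 hin 2
  have e1 : (K₃ * x + K₄ * x ^ 2) ^ 2 = x ^ 2 * (K₃ + K₄ * x) ^ 2 := by ring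
  rw [e1]
  have hprod : x ^ 2 * (K₃ + K₄ * x) ^ 2 ≤ (C₀ ^ 2 * T * t) * (K₃ + K₄ * (C₀ * T)) ^ 2 :=
    mul_le_mul hx2 hsq (sq_nonneg _) (mul_nonneg (mul_nonneg (sq_nonneg _) (ht0.trans htT)) ht0)
  nlinarith [hprod, hx2]

omit [Fintype n] [DecidableEq n] in
/-- `M³·#Plane·ρ-bracket(a₀, α₁) ≤ #Plane·R(αh, αh1)` when `Ma₀ ≤ αh ≤ 1`, `M²α₁ ≤ αh1`, `M ≥ 1` (F48b `rho_currency`, rescaled). [folklore] -/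
theorem rho_scaled {M a₀ α₁ αh αh1 cP : ℝ} (hM : 1 ≤ M) (ha₀ : 0 ≤ a₀) (hα₁ : 0 ≤ α₁) (hx : M * a₀ ≤ αh) (hy : M ^ 2 * α₁ ≤ αh1) (hαh1 : αh ≤ 1)
    (hcP : 0 ≤ cP) :
    M ^ 3 * (cP * (2 * (8 * a₀ * (2 * α₁ + 28 * a₀ ^ 2) + 6 * (Real.exp a₀ - 1) * (2 * α₁ + 24 * (Real.exp a₀ - 1) * a₀)
                  + (2 * α₁ + 24 * (Real.exp a₀ - 1) * a₀) * (2 * α₁ + 28 * a₀ ^ 2) + 960 * (Real.exp a₀ - 1) * a₀ ^ 2)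
                + 64 * a₀ * α₁))
      ≤ cP * (144 * (αh * αh1) + 5440 * αh ^ 3 + 8 * (αh1 * αh1) + 304 * (αh1 * αh ^ 2) + 2688 * αh ^ 4) := by
  have hMpos : 0 < M := by linarith
  have h1 : a₀ ≤ αh / M := by rw [le_div_iff₀ hMpos]; linarith
  have h2 : α₁ ≤ αh1 / M ^ 2 := by rw [le_div_iff₀ (by positivity)]; linarith
  have h := rho_currency hM ha₀ h1 hα₁ h2 hαh1 hcP
  rw [le_div_iff₀ (by positivity)] at h
  linarith

/-! ## §2 The line in letters -/

/-- THE LINE IN LETTERS: every atom of the closed-form constants is a real variable (`M = Mn = L^{k+1}`, `cP = #Plane`, `cn = card n`, `Kd` = F51's bracket,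
`Cc = curl1C∕(1 − thetaLoc·ε)`, `K₃ = 3 + 12(d+1)`, `K₄ = 4K₃³∕ρ₀²`, `Cg, Cd, D, lc, ek, ec, lq` the split∕decay letters, `Ba, Bb` the two EXP brackets, `βp = 4(e^β − 1)`,
`t = r + βp + ε ≤ T = δ + βp + ε`); the two budget inequalities give the line. [folklore] -/
theorem line_core {K M Mn ec cn Cg Cd D lc ek Cc Kd cP K₃ K₄ βp ε r t T C₀ C₁ a₀ a₁ Ba Bb c₀ θ lq : ℝ}
    (hMn : M = Mn) (hK : 0 ≤ K) (hM : 1 ≤ M) (hec : 0 ≤ ec) (hcn : 0 ≤ cn) (hCg : 0 ≤ Cg) (hCd : 0 ≤ Cd) (hD : 0 ≤ D) (hlc : 0 ≤ lc) (hek : 0 ≤ ek)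
    (hCc : 0 ≤ Cc) (hKd : 0 ≤ Kd) (hcP : 0 ≤ cP) (hK₃ : 0 ≤ K₃) (hK₄ : 0 ≤ K₄) (hlq : 0 ≤ lq)
    (hr0 : 0 ≤ r) (hC₀ : 0 ≤ C₀) (ha₀ : 0 ≤ a₀) (ht : t = r + βp + ε) (ht0 : 0 ≤ t) (htT : t ≤ T)
    (hMa₀ : M * a₀ ≤ C₀ * t) (hMa₁ : M ^ 2 * a₁ ≤ C₁ * t)
    (hBa : M ^ 3 * (cP * Ba) ≤ cP * (t * (T * (144 * C₀ * C₁ + 8 * C₁ ^ 2) + T ^ 2 * (5440 * C₀ ^ 3 + 304 * C₁ * C₀ ^ 2) + T ^ 3 * (2688 * C₀ ^ 4))))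
    (hBb : M ^ 3 * (cP * Bb) ≤ cP * (t * (T * (144 * C₀ * (C₀ + C₁) + 8 * (C₀ + C₁) ^ 2) + T ^ 2 * (5440 * C₀ ^ 3 + 304 * (C₀ + C₁) * C₀ ^ 2) + T ^ 3 * (2688 * C₀ ^ 4))))
    (hθ : (K * (2 * Cc * Kd * (C₀ * T)) + K * ec * (2 * Cc * Kd * (C₀ * T) + Cc))
      + (K * (cP * ((T * (144 * C₀ * C₁ + 8 * C₁ ^ 2) + T ^ 2 * (5440 * C₀ ^ 3 + 304 * C₁ * C₀ ^ 2) + T ^ 3 * (2688 * C₀ ^ 4)) + 2 * (T * (144 * C₀ * (C₀ +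
      C₁) + 8 * (C₀ + C₁) ^ 2) + T ^ 2 * (5440 * C₀ ^ 3 + 304 * (C₀ + C₁) * C₀ ^ 2) + T ^ 3 * (2688 * C₀ ^ 4)))) + K * ec * (cP * ((T * (144 * C₀ * C₁ + 8 *
      C₁ ^ 2) + T ^ 2 * (5440 * C₀ ^ 3 + 304 * C₁ * C₀ ^ 2) + T ^ 3 * (2688 * C₀ ^ 4)) + 2 * (T * (144 * C₀ * (C₀ + C₁) + 8 * (C₀ + C₁) ^ 2) + T ^ 2 * (5440
      * C₀ ^ 3 + 304 * (C₀ + C₁) * C₀ ^ 2) + T ^ 3 * (2688 * C₀ ^ 4))) + 4 * cP * (C₀ + C₁)) + cn * Cg * (1 + 12 * D) * ((28 * (K₃ + K₄ * (C₀ * T)) ^ 2 + 4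
      * K₄) * (C₀ ^ 2 * T)) + (cn * (2 * (Cd * (D * (lc * ek))))) * (K₃ * C₀ + D * lq * (2 * K₃ * C₀ + ((28 * (K₃ + K₄ * (C₀ * T)) ^ 2 + 4 * K₄) * (C₀ ^ 2 *
      T)))) + 28 * C₀ ^ 2 * T) ≤ θ)
    (hc₀ : (K * (cP * ((T * (144 * C₀ * C₁ + 8 * C₁ ^ 2) + T ^ 2 * (5440 * C₀ ^ 3 + 304 * C₁ * C₀ ^ 2) + T ^ 3 * (2688 * C₀ ^ 4)) + 2 * (T * (144 * C₀ * (C₀ +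
      C₁) + 8 * (C₀ + C₁) ^ 2) + T ^ 2 * (5440 * C₀ ^ 3 + 304 * (C₀ + C₁) * C₀ ^ 2) + T ^ 3 * (2688 * C₀ ^ 4)))) + K * ec * (cP * ((T * (144 * C₀ * C₁ + 8 *
      C₁ ^ 2) + T ^ 2 * (5440 * C₀ ^ 3 + 304 * C₁ * C₀ ^ 2) + T ^ 3 * (2688 * C₀ ^ 4)) + 2 * (T * (144 * C₀ * (C₀ + C₁) + 8 * (C₀ + C₁) ^ 2) + T ^ 2 * (5440
      * C₀ ^ 3 + 304 * (C₀ + C₁) * C₀ ^ 2) + T ^ 3 * (2688 * C₀ ^ 4))) + 4 * cP * (C₀ + C₁)) + cn * Cg * (1 + 12 * D) * ((28 * (K₃ + K₄ * (C₀ * T)) ^ 2 + 4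
      * K₄) * (C₀ ^ 2 * T)) + (cn * (2 * (Cd * (D * (lc * ek))))) * (K₃ * C₀ + D * lq * (2 * K₃ * C₀ + ((28 * (K₃ + K₄ * (C₀ * T)) ^ 2 + 4 * K₄) * (C₀ ^ 2 *
      T)))) + 28 * C₀ ^ 2 * T) * (βp + ε)
      + (cn * Cg * (1 + 12 * D) + (cn * (2 * (Cd * (D * (lc * ek))))) * (D * lq)) * βp ≤ c₀) :
    K * M * (((r * (M * a₀) * (Cc * (2 * Kd)) / M ^ 3 + (cP * Ba) + (cP * Bb)) + (cP * Bb)) + ec * (((r * (M * a₀) * (Cc * (2 * Kd)) / M ^ 3 + (cP * Ba) +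
      (cP * Bb)) + r * Cc / M ^ 3 + 2 * cP * (2 * (1 / M) * a₁ + 2 / M ^ 2 * a₀)) + (cP * Bb))) + cn * (Cg / Mn * ((1 + 12 * D) * ((βp) + 28 * (K₃ * (M *
      a₀) + K₄ * (M * a₀) ^ 2) ^ 2 + 4 * (K₄ * (M * a₀) ^ 2)) / Mn) + (Mn)⁻¹ * (2 * (Cd * ((D / Mn) * ((K₃ * M * a₀ + D * lq * (2 * (K₃ * M * a₀) + ((βp) +
      28 * (K₃ * (M * a₀) + K₄ * (M * a₀) ^ 2) ^ 2 + 4 * (K₄ * (M * a₀) ^ 2)))) * lc * ek))))) + 28 * a₀ ^ 2 ≤ (c₀ + θ * r) / M ^ 2 := by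
  subst hMn
  have hMpos : 0 < M := by linarith
  -- the coarse-curvature quadratic and the pieces that need `x = M a₀ ≤ C₀ t ≤ C₀ T`
  have hx0 : 0 ≤ M * a₀ := mul_nonneg hMpos.le ha₀
  have hxT : M * a₀ ≤ C₀ * T := hMa₀.trans (mul_le_mul_of_nonneg_left htT hC₀)
  have hQ : (28 * (K₃ * (M * a₀) + K₄ * (M * a₀) ^ 2) ^ 2 + 4 * (K₄ * (M * a₀) ^ 2)) ≤ ((28 * (K₃ + K₄ * (C₀ * T)) ^ 2 + 4 * K₄) * (C₀ ^ 2 * T)) * t := Q_le hx0 hMa₀ ht0 htT hC₀ hK₃ hK₄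
  refine line_scaling hMpos ?_
  -- T1 and T2: the criticality pairing, EXP, the far shell
  have hA : r * (M * a₀) * (Cc * (2 * Kd)) ≤ r * (C₀ * T) * (Cc * (2 * Kd)) := by gcongr
  have e1 : K * M ^ 3 * ((r * (M * a₀) * (Cc * (2 * Kd)) / M ^ 3 + cP * Ba + cP * Bb) + cP * Bb) = K * (r * (M * a₀) * (Cc * (2 * Kd)) + M ^ 3 * (cP * Ba) + 2 * (M ^ 3 * (cP * Bb))) := by
    field_simp
    ring
  have e2 : K * M ^ 3 * (ec * (((r * (M * a₀) * (Cc * (2 * Kd)) / M ^ 3 + cP * Ba + cP * Bb) + r * Cc / M ^ 3 + 2 * cP * (2 * (1 / M) * a₁ + 2 / M ^ 2 * a₀)) + cP * Bb))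
      = K * ec * (r * (M * a₀) * (Cc * (2 * Kd)) + M ^ 3 * (cP * Ba) + 2 * (M ^ 3 * (cP * Bb)) + r * Cc + 4 * cP * (M ^ 2 * a₁ + M * a₀)) := by
    field_simp
    ring
  have hin1 : r * (M * a₀) * (Cc * (2 * Kd)) + M ^ 3 * (cP * Ba) + 2 * (M ^ 3 * (cP * Bb))
      ≤ r * (C₀ * T) * (Cc * (2 * Kd)) + cP * (t * (T * (144 * C₀ * C₁ + 8 * C₁ ^ 2) + T ^ 2 * (5440 * C₀ ^ 3 + 304 * C₁ * C₀ ^ 2) + T ^ 3 * (2688 * C₀ ^ 4))) + 2 * (cP * (t * (T * (144 * C₀ * (C₀ + C₁) + 8 * (C₀ + C₁) ^ 2) + T ^ 2 * (5440 * C₀ ^ 3 + 304 * (C₀ + C₁) * C₀ ^ 2) + T ^ 3 * (2688 * C₀ ^ 4)))) := by linarith only [hA, hBa, hBb]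
  have h4 : 4 * cP * (M ^ 2 * a₁ + M * a₀) ≤ 4 * cP * ((C₀ + C₁) * t) := mul_le_mul_of_nonneg_left (by linarith only [hMa₀, hMa₁]) (by positivity)
  have hT1 : K * M ^ 3 * ((r * (M * a₀) * (Cc * (2 * Kd)) / M ^ 3 + cP * Ba + cP * Bb) + cP * Bb) ≤ K * (r * (C₀ * T) * (Cc * (2 * Kd)) + cP * (t * (T * (144 * C₀ * C₁ + 8 * C₁ ^ 2) + T ^ 2 * (5440 * C₀ ^ 3 + 304 * C₁ * C₀ ^ 2) + T ^ 3 * (2688 * C₀ ^ 4))) + 2 * (cP * (t * (T * (144 * C₀ * (C₀ + C₁) + 8 * (C₀ + C₁) ^ 2) + T ^ 2 * (5440 * C₀ ^ 3 + 304 * (C₀ + C₁) * C₀ ^ 2) + T ^ 3 * (2688 * C₀ ^ 4))))) := by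
    rw [e1]; exact mul_le_mul_of_nonneg_left hin1 hK
  have hT2 : K * M ^ 3 * (ec * (((r * (M * a₀) * (Cc * (2 * Kd)) / M ^ 3 + cP * Ba + cP * Bb) + r * Cc / M ^ 3 + 2 * cP * (2 * (1 / M) * a₁ + 2 / M ^ 2 * a₀)) + cP * Bb))
      ≤ K * ec * (r * (C₀ * T) * (Cc * (2 * Kd)) + cP * (t * (T * (144 * C₀ * C₁ + 8 * C₁ ^ 2) + T ^ 2 * (5440 * C₀ ^ 3 + 304 * C₁ * C₀ ^ 2) + T ^ 3 * (2688 * C₀ ^ 4))) + 2 * (cP * (t * (T * (144 * C₀ * (C₀ + C₁) + 8 * (C₀ + C₁) ^ 2) + T ^ 2 * (5440 * C₀ ^ 3 + 304 * (C₀ + C₁) * C₀ ^ 2) + T ^ 3 * (2688 * C₀ ^ 4)))) + r * Cc + 4 * cP * ((C₀ + C₁) * t)) := by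
    rw [e2]; exact mul_le_mul_of_nonneg_left (by linarith only [hin1, h4]) (mul_nonneg hK hec)
  -- T3: the coarse curvature letter
  have hT3 : cn * (Cg * ((1 + 12 * D) * (βp + 28 * (K₃ * (M * a₀) + K₄ * (M * a₀) ^ 2) ^ 2 + 4 * (K₄ * (M * a₀) ^ 2)))) ≤ cn * (Cg * ((1 + 12 * D) * (βp + ((28 * (K₃ + K₄ * (C₀ * T)) ^ 2 + 4 * K₄) * (C₀ ^ 2 * T)) * t))) := by
    have h1 : βp + (28 * (K₃ * (M * a₀) + K₄ * (M * a₀) ^ 2) ^ 2 + 4 * (K₄ * (M * a₀) ^ 2)) ≤ βp + ((28 * (K₃ + K₄ * (C₀ * T)) ^ 2 + 4 * K₄) * (C₀ ^ 2 * T)) * t := by linarith only [hQ]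
    have h1' : βp + 28 * (K₃ * (M * a₀) + K₄ * (M * a₀) ^ 2) ^ 2 + 4 * (K₄ * (M * a₀) ^ 2) ≤ βp + ((28 * (K₃ + K₄ * (C₀ * T)) ^ 2 + 4 * K₄) * (C₀ ^ 2 * T)) * t := by linarith only [hQ]
    exact mul_le_mul_of_nonneg_left (mul_le_mul_of_nonneg_left (mul_le_mul_of_nonneg_left h1' (by positivity)) hCg) hcn
  -- T4: the split remainder
  have hSb : (K₃ * M * a₀ + D * lq * (2 * (K₃ * M * a₀) + (βp + 28 * (K₃ * (M * a₀) + K₄ * (M * a₀) ^ 2) ^ 2 + 4 * (K₄ * (M * a₀) ^ 2)))) ≤ (K₃ * C₀ + D * lq * (2 * K₃ * C₀ + ((28 * (K₃ + K₄ * (C₀ * T)) ^ 2 + 4 * K₄) * (C₀ ^ 2 * T)))) * t + D * lq * βp := by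
    have h1 : K₃ * M * a₀ ≤ K₃ * C₀ * t := by nlinarith only [hMa₀, hK₃]
    have h2 : 0 ≤ D * lq := mul_nonneg hD hlq
    nlinarith only [h1, hQ, h2, mul_le_mul_of_nonneg_left (show 2 * (K₃ * M * a₀) + (βp + (28 * (K₃ * (M * a₀) + K₄ * (M * a₀) ^ 2) ^ 2 + 4 * (K₄ * (M * a₀) ^ 2))) ≤ 2 * (K₃ * C₀ * t) + (βp + ((28 * (K₃ + K₄ * (C₀ * T)) ^ 2 + 4 * K₄) * (C₀ ^ 2 * T)) * t) by linarith only [h1, hQ]) h2]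
  have hT4 : cn * (2 * (Cd * (D * ((K₃ * M * a₀ + D * lq * (2 * (K₃ * M * a₀) + (βp + 28 * (K₃ * (M * a₀) + K₄ * (M * a₀) ^ 2) ^ 2 + 4 * (K₄ * (M * a₀) ^ 2)))) * lc * ek))))
      ≤ cn * (2 * (Cd * (D * (((K₃ * C₀ + D * lq * (2 * K₃ * C₀ + ((28 * (K₃ + K₄ * (C₀ * T)) ^ 2 + 4 * K₄) * (C₀ ^ 2 * T)))) * t + D * lq * βp) * lc * ek)))) := by
    have h1 := mul_le_mul_of_nonneg_right (mul_le_mul_of_nonneg_right hSb hlc) hek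
    exact mul_le_mul_of_nonneg_left (mul_le_mul_of_nonneg_left (mul_le_mul_of_nonneg_left (mul_le_mul_of_nonneg_left h1 hD) hCd) zero_le_two) hcn
  -- T5
  have hT5 : 28 * (M * a₀) ^ 2 ≤ 28 * C₀ ^ 2 * T * t := by
    have h1 : (M * a₀) ^ 2 ≤ (C₀ * t) ^ 2 := pow_le_pow_left₀ hx0 hMa₀ 2
    nlinarith only [h1, mul_le_mul_of_nonneg_left htT (show 0 ≤ C₀ ^ 2 * t by positivity)]
  -- the budget
  have hsum := add_le_add (add_le_add (add_le_add (add_le_add hT1 hT2) hT3) hT4) hT5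
  have hθr := mul_le_mul_of_nonneg_right hθ hr0
  calc K * M ^ 3 * (((r * (M * a₀) * (Cc * (2 * Kd)) / M ^ 3 + cP * Ba + cP * Bb) + cP * Bb) + ec * (((r * (M * a₀) * (Cc * (2 * Kd)) / M ^ 3 + cP * Ba + cP
        * Bb) + r * Cc / M ^ 3 + 2 * cP * (2 * (1 / M) * a₁ + 2 / M ^ 2 * a₀)) + cP * Bb)) + cn * (Cg * ((1 + 12 * D) * (βp + 28 * (K₃ * (M * a₀) + K₄ * (M *
        a₀) ^ 2) ^ 2 + 4 * (K₄ * (M * a₀) ^ 2))) + 2 * (Cd * (D * ((K₃ * M * a₀ + D * lq * (2 * (K₃ * M * a₀) + (βp + 28 * (K₃ * (M * a₀) + K₄ * (M * a₀) ^ 2)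
        ^ 2 + 4 * (K₄ * (M * a₀) ^ 2)))) * lc * ek)))) + 28 * (M * a₀) ^ 2
      = K * M ^ 3 * ((r * (M * a₀) * (Cc * (2 * Kd)) / M ^ 3 + cP * Ba + cP * Bb) + cP * Bb) + K * M ^ 3 * (ec * (((r * (M * a₀) * (Cc * (2 * Kd)) / M ^ 3 +
        cP * Ba + cP * Bb) + r * Cc / M ^ 3 + 2 * cP * (2 * (1 / M) * a₁ + 2 / M ^ 2 * a₀)) + cP * Bb)) + cn * (Cg * ((1 + 12 * D) * (βp + 28 * (K₃ * (M * a₀)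
        + K₄ * (M * a₀) ^ 2) ^ 2 + 4 * (K₄ * (M * a₀) ^ 2)))) + cn * (2 * (Cd * (D * ((K₃ * M * a₀ + D * lq * (2 * (K₃ * M * a₀) + (βp + 28 * (K₃ * (M * a₀) +
        K₄ * (M * a₀) ^ 2) ^ 2 + 4 * (K₄ * (M * a₀) ^ 2)))) * lc * ek)))) + 28 * (M * a₀) ^ 2 := by ring
    _ ≤ K * (r * (C₀ * T) * (Cc * (2 * Kd)) + cP * (t * (T * (144 * C₀ * C₁ + 8 * C₁ ^ 2) + T ^ 2 * (5440 * C₀ ^ 3 + 304 * C₁ * C₀ ^ 2) + T ^ 3 * (2688 * C₀ ^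
        4))) + 2 * (cP * (t * (T * (144 * C₀ * (C₀ + C₁) + 8 * (C₀ + C₁) ^ 2) + T ^ 2 * (5440 * C₀ ^ 3 + 304 * (C₀ + C₁) * C₀ ^ 2) + T ^ 3 * (2688 * C₀ ^
        4))))) + K * ec * (r * (C₀ * T) * (Cc * (2 * Kd)) + cP * (t * (T * (144 * C₀ * C₁ + 8 * C₁ ^ 2) + T ^ 2 * (5440 * C₀ ^ 3 + 304 * C₁ * C₀ ^ 2) + T ^ 3
        * (2688 * C₀ ^ 4))) + 2 * (cP * (t * (T * (144 * C₀ * (C₀ + C₁) + 8 * (C₀ + C₁) ^ 2) + T ^ 2 * (5440 * C₀ ^ 3 + 304 * (C₀ + C₁) * C₀ ^ 2) + T ^ 3 *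
        (2688 * C₀ ^ 4)))) + r * Cc + 4 * cP * ((C₀ + C₁) * t)) + cn * (Cg * ((1 + 12 * D) * (βp + ((28 * (K₃ + K₄ * (C₀ * T)) ^ 2 + 4 * K₄) * (C₀ ^ 2 * T)) *
        t))) + cn * (2 * (Cd * (D * (((K₃ * C₀ + D * lq * (2 * K₃ * C₀ + ((28 * (K₃ + K₄ * (C₀ * T)) ^ 2 + 4 * K₄) * (C₀ ^ 2 * T)))) * t + D * lq * βp) * lc *
        ek)))) + 28 * C₀ ^ 2 * T * t := hsum
    _ = (K * (2 * Cc * Kd * (C₀ * T)) + K * ec * (2 * Cc * Kd * (C₀ * T) + Cc)) * r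
        + (K * (cP * ((T * (144 * C₀ * C₁ + 8 * C₁ ^ 2) + T ^ 2 * (5440 * C₀ ^ 3 + 304 * C₁ * C₀ ^ 2) + T ^ 3 * (2688 * C₀ ^ 4)) + 2 * (T * (144 * C₀ * (C₀ +
        C₁) + 8 * (C₀ + C₁) ^ 2) + T ^ 2 * (5440 * C₀ ^ 3 + 304 * (C₀ + C₁) * C₀ ^ 2) + T ^ 3 * (2688 * C₀ ^ 4)))) + K * ec * (cP * ((T * (144 * C₀ * C₁ + 8 *
        C₁ ^ 2) + T ^ 2 * (5440 * C₀ ^ 3 + 304 * C₁ * C₀ ^ 2) + T ^ 3 * (2688 * C₀ ^ 4)) + 2 * (T * (144 * C₀ * (C₀ + C₁) + 8 * (C₀ + C₁) ^ 2) + T ^ 2 * (5440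
        * C₀ ^ 3 + 304 * (C₀ + C₁) * C₀ ^ 2) + T ^ 3 * (2688 * C₀ ^ 4))) + 4 * cP * (C₀ + C₁)) + cn * Cg * (1 + 12 * D) * ((28 * (K₃ + K₄ * (C₀ * T)) ^ 2 + 4
        * K₄) * (C₀ ^ 2 * T)) + (cn * (2 * (Cd * (D * (lc * ek))))) * (K₃ * C₀ + D * lq * (2 * K₃ * C₀ + ((28 * (K₃ + K₄ * (C₀ * T)) ^ 2 + 4 * K₄) * (C₀ ^ 2 *
        T)))) + 28 * C₀ ^ 2 * T) * t
        + (cn * Cg * (1 + 12 * D) + (cn * (2 * (Cd * (D * (lc * ek))))) * (D * lq)) * βp := by ring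
    _ ≤ c₀ + θ * r := by rw [ht]; nlinarith only [hθr, hc₀]

/-! ## §3 The line from the budget -/

/-- The closed-form constants are non-negative (proved in a clean context: `positivity` must not meet the budget hypotheses). [folklore] -/
theorem consts_nonneg (L ℓ : ℕ) :
    (0 : ℝ) ≤ (8 * (3 + 12 * ((d + 1 : ℕ) : ℝ)) * (2 + 2 * ((((d + 1 : ℕ) : ℝ) + 1) * L)
        * (1 + ((1250 * ((nbRad (d + 1) L : ℝ) + L) + 8 * (((d + 1 : ℕ) : ℝ) * L) + 2 * L) * (((d + 1 : ℕ) : ℝ) * (2 * nbRad (d + 1) L + 1) ^ (d + 1)))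
          / ((L : ℝ) / (L : ℝ) ^ (d + 1))))) ∧
    (0 : ℝ) ≤ (2 * (CdecD d * (((d : ℝ) + 1) * (2 * ((d : ℝ) + 1))
              * ((2 + 32 / (kappa163 (d + 1) / (d + 1)) ^ 2) * latticeConst (d + 1) (kappa163 (d + 1) / (d + 1) / 2))))) ∧
    (0 : ℝ) ≤ (3 + 12 * ((d + 1 : ℕ) : ℝ)) ∧ (0 : ℝ) ≤ (4 * (3 + 12 * ((d + 1 : ℕ) : ℝ)) ^ 3 / rho0 (d + 1) L ^ 2) ∧ (0 : ℝ) ≤ (d : ℝ) + 1 ∧ (0 : ℝ) ≤ 4 * ((ℓ + 1 : ℕ) : ℝ) + 2 := by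
  have hCd : (0 : ℝ) ≤ CdecD d := CdecD_nonneg
  have hκ : (0 : ℝ) ≤ kappa163 (d + 1) / (d + 1) / 2 := by have := kappa163_pos (d + 1); positivity
  have hlc : (0 : ℝ) ≤ latticeConst (d + 1) (kappa163 (d + 1) / (d + 1) / 2) := latticeConst_nonneg _ hκ
  have hK3 : (0 : ℝ) ≤ (3 + 12 * ((d + 1 : ℕ) : ℝ)) := by positivity
  exact ⟨by positivity, by positivity, hK3, div_nonneg (mul_nonneg (by norm_num) (pow_nonneg hK3 3)) (sq_nonneg _), by positivity, by positivity⟩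

set_option maxHeartbeats 400000 in
omit [DecidableEq n] in
/-- **THE SCALAR LINE OF F279 FROM THE BUDGET** (statement: module docstring §2; the conclusion is the `hline` binder of
`NE7HapeOfLocalChart.hape_of_localChart` VERBATIM; the statement alone is several thousand tokens, whence the doubled heartbeat budget — the proof is a
term-mode instantiation of `line_core`). [folklore] -/
theorem line_of_budget {L : ℕ} (hL : 2 ≤ L) {K c : ℝ} (hK : 0 ≤ K) (ℓ : ℕ) {ε δ β c₀ θ C₀ C₁ : ℝ}
    (hε : 0 ≤ ε) (hβ : 0 ≤ β) (hC₀ : 0 ≤ C₀) (hC₁ : 0 ≤ C₁) (hθl : thetaLoc (d + 1) L * ε < 1)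
    (hC₀T : C₀ * (δ + 4 * (Real.exp β - 1) + ε) ≤ 1)
    (hθ : (K * (2 * (curl1C (d + 1) L / (1 - thetaLoc (d + 1) L * ε)) * (8 * (3 + 12 * ((d + 1 : ℕ) : ℝ)) * (2 + 2 * ((((d + 1 : ℕ) : ℝ) + 1) * L)
        * (1 + ((1250 * ((nbRad (d + 1) L : ℝ) + L) + 8 * (((d + 1 : ℕ) : ℝ) * L) + 2 * L) * (((d + 1 : ℕ) : ℝ) * (2 * nbRad (d + 1) L + 1) ^ (d + 1)))
          / ((L : ℝ) / (L : ℝ) ^ (d + 1))))) * (C₀ * (δ + 4 * (Real.exp β - 1) + ε))) + K * Real.exp (-(c * ℓ)) * (2 * (curl1C (d + 1) L / (1 - thetaLoc (d + 1) L * ε)) * (8 * (3 + 12 * ((d + 1 : ℕ) : ℝ)) * (2 + 2 * ((((d + 1 : ℕ) : ℝ) + 1) * L)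
        * (1 + ((1250 * ((nbRad (d + 1) L : ℝ) + L) + 8 * (((d + 1 : ℕ) : ℝ) * L) + 2 * L) * (((d + 1 : ℕ) : ℝ) * (2 * nbRad (d + 1) L + 1) ^ (d + 1)))
          / ((L : ℝ) / (L : ℝ) ^ (d + 1))))) * (C₀ * (δ + 4 * (Real.exp β - 1) + ε)) + (curl1C (d + 1) L / (1 - thetaLoc (d + 1) L * ε))))
      + (K * ((Fintype.card (T4AveragingDeficitWall.Plane (d + 1)) : ℝ) * (((δ + 4 * (Real.exp β - 1) + ε) * (144 * C₀ * C₁ + 8 * C₁ ^ 2) + (δ + 4 * (Real.exp β - 1) + ε) ^ 2 * (5440 * C₀ ^ 3 + 304 * C₁ * C₀ ^ 2) + (δ + 4 * (Real.exp β - 1) + ε) ^ 3 * (2688 * C₀ ^ 4)) + 2 * ((δ + 4 * (Real.exp β - 1) + ε) * (144 * C₀ * (C₀ + C₁) + 8 * (C₀ + C₁) ^ 2) + (δ + 4 * (Real.exp β - 1) + ε) ^ 2 * (5440 * C₀ ^ 3 + 304 * (C₀ + C₁) * C₀ ^ 2) + (δ + 4 * (Real.exp β - 1) + ε) ^ 3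 * (2688 * C₀ ^ 4))))
      + K * Real.exp (-(c * ℓ)) * ((Fintype.card (T4AveragingDeficitWall.Plane (d + 1)) : ℝ) * (((δ + 4 * (Real.exp β - 1) + ε) * (144 * C₀ * C₁ + 8 * C₁ ^ 2) + (δ + 4 * (Real.exp β - 1) + ε) ^ 2 * (5440 * C₀ ^ 3 + 304 * C₁ * C₀ ^ 2) + (δ + 4 * (Real.exp β - 1) + ε) ^ 3 * (2688 * C₀ ^ 4)) + 2 * ((δ + 4 * (Real.exp β - 1) + ε) * (144 * C₀ * (C₀ + C₁) + 8 * (C₀ + C₁) ^ 2) + (δ + 4 * (Real.exp β - 1) + ε) ^ 2 * (5440 * C₀ ^ 3 + 304 * (C₀ + C₁) * C₀ ^ 2) + (δ + 4 * (Real.exp β - 1) + ε) ^ 3 * (2688 * C₀ ^ 4))) + 4 * (Fintype.card (T4AveragingDeficitWall.Plane (d + 1)) : ℝ) * (C₀ + C₁))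
      + (Fintype.card n : ℝ) * (2 * (CdecD d * (((d : ℝ) + 1) * (2 * ((d : ℝ) + 1))
              * ((2 + 32 / (kappa163 (d + 1) / (d + 1)) ^ 2) * latticeConst (d + 1) (kappa163 (d + 1) / (d + 1) / 2))))) * (1 + 12 * ((d : ℝ) + 1)) * ((28 * ((3 + 12 * ((d + 1 : ℕ) : ℝ)) + (4 * (3 + 12 * ((d + 1 : ℕ) : ℝ)) ^ 3 / rho0 (d + 1) L ^ 2) * (C₀ * (δ + 4 * (Real.exp β - 1) + ε))) ^ 2 + 4 * (4 * (3 + 12 * ((d + 1 : ℕ) : ℝ)) ^ 3 / rho0 (d + 1) L ^ 2)) * (C₀ ^ 2 * (δ + 4 * (Real.exp β - 1) + ε)))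
      + ((Fintype.card n : ℝ) * (2 * (CdecD d * (((d : ℝ) + 1) * (latticeConst (d + 1) (kappa163 (d + 1) / (d + 1) / 2) * Real.exp (-(kappa163 (d + 1) / (d + 1) / 2 * ℓ))))))) * ((3 + 12 * ((d + 1 : ℕ) : ℝ)) * C₀ + ((d : ℝ) + 1) * (4 * ((ℓ + 1 : ℕ) : ℝ) + 2) * (2 * (3 + 12 * ((d + 1 : ℕ) : ℝ)) * C₀ + ((28 * ((3 + 12 * ((d + 1 : ℕ) : ℝ)) + (4 * (3 + 12 * ((d + 1 : ℕ) : ℝ)) ^ 3 / rho0 (d + 1) L ^ 2) * (C₀ * (δ + 4 * (Real.exp β - 1) + ε))) ^ 2 + 4 * (4 * (3 + 12 * ((d + 1 : ℕ) : ℝ)) ^ 3 / rho0 (d + 1) L ^ 2)) * (C₀ ^ 2 * (δ + 4 * (Real.exp β - 1) + ε))))) + 28 * C₀ ^ 2 * (δ + 4 * (Real.exp β - 1) + ε)) ≤ θ)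
    (hc₀ : (K * ((Fintype.card (T4AveragingDeficitWall.Plane (d + 1)) : ℝ) * (((δ + 4 * (Real.exp β - 1) + ε) * (144 * C₀ * C₁ + 8 * C₁ ^ 2) + (δ + 4 * (Real.exp β - 1) + ε) ^ 2 * (5440 * C₀ ^ 3 + 304 * C₁ * C₀ ^ 2) + (δ + 4 * (Real.exp β - 1) + ε) ^ 3 * (2688 * C₀ ^ 4)) + 2 * ((δ + 4 * (Real.exp β - 1) + ε) * (144 * C₀ * (C₀ + C₁) + 8 * (C₀ + C₁) ^ 2) + (δ + 4 * (Real.exp β - 1) + ε) ^ 2 * (5440 * C₀ ^ 3 + 304 * (C₀ + C₁) * C₀ ^ 2) + (δ + 4 * (Real.exp β - 1) + ε) ^ 3 * (2688 * C₀ ^ 4))))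
      + K * Real.exp (-(c * ℓ)) * ((Fintype.card (T4AveragingDeficitWall.Plane (d + 1)) : ℝ) * (((δ + 4 * (Real.exp β - 1) + ε) * (144 * C₀ * C₁ + 8 * C₁ ^ 2) + (δ + 4 * (Real.exp β - 1) + ε) ^ 2 * (5440 * C₀ ^ 3 + 304 * C₁ * C₀ ^ 2) + (δ + 4 * (Real.exp β - 1) + ε) ^ 3 * (2688 * C₀ ^ 4)) + 2 * ((δ + 4 * (Real.exp β - 1) + ε) * (144 * C₀ * (C₀ + C₁) + 8 * (C₀ + C₁) ^ 2) + (δ + 4 * (Real.exp β - 1) + ε) ^ 2 * (5440 * C₀ ^ 3 + 304 * (C₀ + C₁) * C₀ ^ 2) + (δ + 4 * (Real.exp β - 1) + ε) ^ 3 * (2688 * C₀ ^ 4))) + 4 * (Fintype.card (T4AveragingDeficitWall.Plane (d + 1)) : ℝ) * (C₀ + C₁))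
      + (Fintype.card n : ℝ) * (2 * (CdecD d * (((d : ℝ) + 1) * (2 * ((d : ℝ) + 1))
              * ((2 + 32 / (kappa163 (d + 1) / (d + 1)) ^ 2) * latticeConst (d + 1) (kappa163 (d + 1) / (d + 1) / 2))))) * (1 + 12 * ((d : ℝ) + 1)) * ((28 * ((3 + 12 * ((d + 1 : ℕ) : ℝ)) + (4 * (3 + 12 * ((d + 1 : ℕ) : ℝ)) ^ 3 / rho0 (d + 1) L ^ 2) * (C₀ * (δ + 4 * (Real.exp β - 1) + ε))) ^ 2 + 4 * (4 * (3 + 12 * ((d + 1 : ℕ) : ℝ)) ^ 3 / rho0 (d + 1) L ^ 2)) * (C₀ ^ 2 * (δ + 4 * (Real.exp β - 1) + ε)))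
      + ((Fintype.card n : ℝ) * (2 * (CdecD d * (((d : ℝ) + 1) * (latticeConst (d + 1) (kappa163 (d + 1) / (d + 1) / 2) * Real.exp (-(kappa163 (d + 1) / (d + 1) / 2 * ℓ))))))) * ((3 + 12 * ((d + 1 : ℕ) : ℝ)) * C₀ + ((d : ℝ) + 1) * (4 * ((ℓ + 1 : ℕ) : ℝ) + 2) * (2 * (3 + 12 * ((d + 1 : ℕ) : ℝ)) * C₀ + ((28 * ((3 + 12 * ((d + 1 : ℕ) : ℝ)) + (4 * (3 + 12 * ((d + 1 : ℕ) : ℝ)) ^ 3 / rho0 (d + 1) L ^ 2) * (C₀ * (δ + 4 * (Real.exp β - 1) + ε))) ^ 2 + 4 * (4 * (3 + 12 * ((d + 1 : ℕ) : ℝ)) ^ 3 / rho0 (d + 1) L ^ 2)) * (C₀ ^ 2 * (δ + 4 * (Real.exp β - 1) + ε))))) + 28 * C₀ ^ 2 * (δ + 4 * (Real.exp β - 1) + ε)) * (4 * (Real.exp β - 1) + ε)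
      + ((Fintype.card n : ℝ) * (2 * (CdecD d * (((d : ℝ) + 1) * (2 * ((d : ℝ) + 1))
              * ((2 + 32 / (kappa163 (d + 1) / (d + 1)) ^ 2) * latticeConst (d + 1) (kappa163 (d + 1) / (d + 1) / 2))))) * (1 + 12 * ((d : ℝ) + 1)) + ((Fintype.card n : ℝ) * (2 * (CdecD d * (((d : ℝ) + 1) * (latticeConst (d + 1) (kappa163 (d + 1) / (d + 1) / 2) * Real.exp (-(kappa163 (d + 1) / (d + 1) / 2 * ℓ))))))) * (((d : ℝ) + 1) * (4 * ((ℓ + 1 : ℕ) : ℝ) + 2))) * (4 * (Real.exp β - 1)) ≤ c₀) :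
    ∀ (k : ℕ) (r a₀ a₁ : ℝ), 0 ≤ r → r ≤ δ → 0 ≤ a₀ → 0 ≤ a₁ →
      (L : ℝ) ^ (k + 1) * a₀ ≤ C₀ * (r + 4 * (Real.exp β - 1) + ε) → ((L : ℝ) ^ (k + 1)) ^ 2 * a₁ ≤ C₁ * (r + 4 * (Real.exp β - 1) + ε) →
      K * (L : ℝ) ^ (k + 1) * (((r * ((L : ℝ) ^ (k + 1) * a₀) * ((curl1C (d + 1) L / (1 - thetaLoc (d + 1) L * ε))
                * (2 * (8 * (3 + 12 * ((d + 1 : ℕ) : ℝ)) * (2 + 2 * ((((d + 1 : ℕ) : ℝ) + 1) * L)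
                  * (1 + ((1250 * ((nbRad (d + 1) L : ℝ) + L) + 8 * (((d + 1 : ℕ) : ℝ) * L) + 2 * L)
                      * (((d + 1 : ℕ) : ℝ) * (2 * nbRad (d + 1) L + 1) ^ (d + 1))) / ((L : ℝ) / (L : ℝ) ^ (d + 1)))))))
              / ((L : ℝ) ^ (k + 1)) ^ 3
            + ((Fintype.card (T4AveragingDeficitWall.Plane (d + 1)) : ℝ)
              * (2 * (8 * a₀ * (2 * a₁ + 28 * a₀ ^ 2) + 6 * (Real.exp a₀ - 1) * (2 * a₁ + 24 * (Real.exp a₀ - 1) * a₀)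
                  + (2 * a₁ + 24 * (Real.exp a₀ - 1) * a₀) * (2 * a₁ + 28 * a₀ ^ 2) + 960 * (Real.exp a₀ - 1) * a₀ ^ 2)
                + 64 * a₀ * a₁))
            + ((Fintype.card (T4AveragingDeficitWall.Plane (d + 1)) : ℝ)
              * (2 * (8 * a₀ * (2 * (a₁ + 1 / (L : ℝ) ^ (k + 1) * a₀) + 28 * a₀ ^ 2)
                  + 6 * (Real.exp a₀ - 1) * (2 * (a₁ + 1 / (L : ℝ) ^ (k + 1) * a₀) + 24 * (Real.exp a₀ - 1) * a₀)
                  + (2 * (a₁ + 1 / (L : ℝ) ^ (k + 1) * a₀) + 24 * (Real.exp a₀ - 1) * a₀) * (2 * (a₁ + 1 / (L : ℝ) ^ (k + 1) * a₀) + 28 * a₀ ^ 2)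
                  + 960 * (Real.exp a₀ - 1) * a₀ ^ 2)
                + 64 * a₀ * (a₁ + 1 / (L : ℝ) ^ (k + 1) * a₀)))) + ((Fintype.card (T4AveragingDeficitWall.Plane (d + 1)) : ℝ)
              * (2 * (8 * a₀ * (2 * (a₁ + 1 / (L : ℝ) ^ (k + 1) * a₀) + 28 * a₀ ^ 2) + 6 * (Real.exp a₀ - 1) * (2 * (a₁ + 1 / (L : ℝ) ^ (k + 1) * a₀) + 24 * (Real.exp a₀ - 1) * a₀)
                  + (2 * (a₁ + 1 / (L : ℝ) ^ (k + 1) * a₀) + 24 * (Real.exp a₀ - 1) * a₀) * (2 * (a₁ + 1 / (L : ℝ) ^ (k + 1) * a₀) + 28 * a₀ ^ 2) + 960 * (Real.exp a₀ - 1) * a₀ ^ 2)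
                + 64 * a₀ * (a₁ + 1 / (L : ℝ) ^ (k + 1) * a₀))))
              + Real.exp (-(c * ℓ)) * (((r * ((L : ℝ) ^ (k + 1) * a₀) * ((curl1C (d + 1) L / (1 - thetaLoc (d + 1) L * ε))
                * (2 * (8 * (3 + 12 * ((d + 1 : ℕ) : ℝ)) * (2 + 2 * ((((d + 1 : ℕ) : ℝ) + 1) * L)
                  * (1 + ((1250 * ((nbRad (d + 1) L : ℝ) + L) + 8 * (((d + 1 : ℕ) : ℝ) * L) + 2 * L)
                      * (((d + 1 : ℕ) : ℝ) * (2 * nbRad (d + 1) L + 1) ^ (d + 1))) / ((L : ℝ) / (L : ℝ) ^ (d + 1)))))))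
              / ((L : ℝ) ^ (k + 1)) ^ 3
            + ((Fintype.card (T4AveragingDeficitWall.Plane (d + 1)) : ℝ)
              * (2 * (8 * a₀ * (2 * a₁ + 28 * a₀ ^ 2) + 6 * (Real.exp a₀ - 1) * (2 * a₁ + 24 * (Real.exp a₀ - 1) * a₀)
                  + (2 * a₁ + 24 * (Real.exp a₀ - 1) * a₀) * (2 * a₁ + 28 * a₀ ^ 2) + 960 * (Real.exp a₀ - 1) * a₀ ^ 2)
                + 64 * a₀ * a₁))
            + ((Fintype.card (T4AveragingDeficitWall.Plane (d + 1)) : ℝ)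
              * (2 * (8 * a₀ * (2 * (a₁ + 1 / (L : ℝ) ^ (k + 1) * a₀) + 28 * a₀ ^ 2)
                  + 6 * (Real.exp a₀ - 1) * (2 * (a₁ + 1 / (L : ℝ) ^ (k + 1) * a₀) + 24 * (Real.exp a₀ - 1) * a₀)
                  + (2 * (a₁ + 1 / (L : ℝ) ^ (k + 1) * a₀) + 24 * (Real.exp a₀ - 1) * a₀) * (2 * (a₁ + 1 / (L : ℝ) ^ (k + 1) * a₀) + 28 * a₀ ^ 2)
                  + 960 * (Real.exp a₀ - 1) * a₀ ^ 2)
                + 64 * a₀ * (a₁ + 1 / (L : ℝ) ^ (k + 1) * a₀))))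
            + r * (curl1C (d + 1) L / (1 - thetaLoc (d + 1) L * ε)) / ((L : ℝ) ^ (k + 1)) ^ 3
            + 2 * (Fintype.card (T4AveragingDeficitWall.Plane (d + 1)) : ℝ)
              * (2 * (1 / (L : ℝ) ^ (k + 1)) * a₁ + 2 / ((L : ℝ) ^ (k + 1)) ^ 2 * a₀)) + ((Fintype.card (T4AveragingDeficitWall.Plane (d + 1)) : ℝ)
              * (2 * (8 * a₀ * (2 * (a₁ + 1 / (L : ℝ) ^ (k + 1) * a₀) + 28 * a₀ ^ 2) + 6 * (Real.exp a₀ - 1) * (2 * (a₁ + 1 / (L : ℝ) ^ (k + 1) * a₀) + 24 * (Real.exp a₀ - 1) * a₀)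
                  + (2 * (a₁ + 1 / (L : ℝ) ^ (k + 1) * a₀) + 24 * (Real.exp a₀ - 1) * a₀) * (2 * (a₁ + 1 / (L : ℝ) ^ (k + 1) * a₀) + 28 * a₀ ^ 2) + 960 * (Real.exp a₀ - 1) * a₀ ^ 2)
                + 64 * a₀ * (a₁ + 1 / (L : ℝ) ^ (k + 1) * a₀)))))
            + Fintype.card n * ((2 * (CdecD d * (((d : ℝ) + 1) * (2 * ((d : ℝ) + 1))
              * ((2 + 32 / (kappa163 (d + 1) / (d + 1)) ^ 2) * latticeConst (d + 1) (kappa163 (d + 1) / (d + 1) / 2)))))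
                / ((L ^ (k + 1) : ℕ) : ℝ) * ((1 + 12 * ((d : ℝ) + 1)) * ((4 * (Real.exp β - 1)) + 28 * ((3 + 12 * ((d + 1 : ℕ) : ℝ)) * ((L : ℝ) ^ (k + 1) * a₀)
              + 4 * (3 + 12 * ((d + 1 : ℕ) : ℝ)) ^ 3 / rho0 (d + 1) L ^ 2 * ((L : ℝ) ^ (k + 1) * a₀) ^ 2) ^ 2
              + 4 * (4 * (3 + 12 * ((d + 1 : ℕ) : ℝ)) ^ 3 / rho0 (d + 1) L ^ 2 * ((L : ℝ) ^ (k + 1) * a₀) ^ 2)) / ((L ^ (k + 1) : ℕ) : ℝ))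
              + (((L ^ (k + 1) : ℕ) : ℝ))⁻¹ * (2 * (CdecD d * ((((d : ℝ) + 1) / ((L ^ (k + 1) : ℕ) : ℝ))
                * (((3 + 12 * ((d + 1 : ℕ) : ℝ)) * (L : ℝ) ^ (k + 1) * a₀
            + ((d : ℝ) + 1) * (4 * ((ℓ + 1 : ℕ) : ℝ) + 2) * (2 * ((3 + 12 * ((d + 1 : ℕ) : ℝ)) * (L : ℝ) ^ (k + 1) * a₀)
              + ((4 * (Real.exp β - 1)) + 28 * ((3 + 12 * ((d + 1 : ℕ) : ℝ)) * ((L : ℝ) ^ (k + 1) * a₀)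
                + 4 * (3 + 12 * ((d + 1 : ℕ) : ℝ)) ^ 3 / rho0 (d + 1) L ^ 2 * ((L : ℝ) ^ (k + 1) * a₀) ^ 2) ^ 2
                + 4 * (4 * (3 + 12 * ((d + 1 : ℕ) : ℝ)) ^ 3 / rho0 (d + 1) L ^ 2 * ((L : ℝ) ^ (k + 1) * a₀) ^ 2)))) * latticeConst (d + 1) (kappa163 (d + 1) / (d + 1) / 2) * Real.exp (-(kappa163 (d + 1) / (d + 1) / 2 * ℓ)))))))
            + 28 * a₀ ^ 2 ≤ (c₀ + θ * r) / ((L : ℝ) ^ (k + 1)) ^ 2 := by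
  intro k r a₀ a₁ hr0 hrδ ha₀ ha₁ hMa₀ hMa₁
  have hL1 : (1 : ℝ) ≤ L := Nat.one_le_cast.mpr (by omega)
  have hMr : ((L ^ (k + 1) : ℕ) : ℝ) = (L : ℝ) ^ (k + 1) := Nat.cast_pow L (k + 1)
  have hM1 : (1 : ℝ) ≤ (L : ℝ) ^ (k + 1) := one_le_pow₀ hL1
  have hMpos : (0 : ℝ) < (L : ℝ) ^ (k + 1) := lt_of_lt_of_le one_pos hM1
  obtain ⟨hKd, hCg, hK3, hK4, hD, hlq⟩ := consts_nonneg (d := d) L ℓ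
  have hβp : (0 : ℝ) ≤ 4 * (Real.exp β - 1) :=
    mul_nonneg zero_le_four (sub_nonneg.mpr ((le_add_of_nonneg_left hβ).trans (Real.add_one_le_exp β)))
  have ht0 : 0 ≤ r + 4 * (Real.exp β - 1) + ε := add_nonneg (add_nonneg hr0 hβp) hε
  have htT : r + 4 * (Real.exp β - 1) + ε ≤ δ + 4 * (Real.exp β - 1) + ε := add_le_add (add_le_add hrδ le_rfl) le_rfl
  have hC₀t1 : C₀ * (r + 4 * (Real.exp β - 1) + ε) ≤ 1 := (mul_le_mul_of_nonneg_left htT hC₀).trans hC₀T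
  have hcP : (0 : ℝ) ≤ (Fintype.card (T4AveragingDeficitWall.Plane (d + 1)) : ℝ) := Nat.cast_nonneg _
  have hα₁' : (0 : ℝ) ≤ a₁ + 1 / (L : ℝ) ^ (k + 1) * a₀ := add_nonneg ha₁ (mul_nonneg (one_div_nonneg.mpr hMpos.le) ha₀)
  have hMM : ((L : ℝ) ^ (k + 1)) ^ 2 * (1 / (L : ℝ) ^ (k + 1)) = (L : ℝ) ^ (k + 1) := by
    rw [sq, mul_assoc, mul_one_div_cancel hMpos.ne', mul_one]
  have hy : ((L : ℝ) ^ (k + 1)) ^ 2 * (a₁ + 1 / (L : ℝ) ^ (k + 1) * a₀) ≤ (C₀ + C₁) * (r + 4 * (Real.exp β - 1) + ε) := by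
    rw [mul_add, ← mul_assoc, hMM, add_mul, add_comm (C₀ * _)]
    exact add_le_add hMa₁ hMa₀
  have hBa := (rho_scaled hM1 ha₀ ha₁ hMa₀ hMa₁ hC₀t1 hcP).trans (mul_le_mul_of_nonneg_left (R_poly_le (C := C₁) ht0 htT hC₀ hC₁) hcP)
  have hBb := (rho_scaled hM1 ha₀ hα₁' hMa₀ hy hC₀t1 hcP).trans
    (mul_le_mul_of_nonneg_left (R_poly_le (C := C₀ + C₁) ht0 htT hC₀ (add_nonneg hC₀ hC₁)) hcP)
  have hCd : (0 : ℝ) ≤ CdecD d := CdecD_nonneg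
  have hκ : (0 : ℝ) ≤ kappa163 (d + 1) / (d + 1) / 2 := by have := kappa163_pos (d + 1); positivity
  have hlc : (0 : ℝ) ≤ latticeConst (d + 1) (kappa163 (d + 1) / (d + 1) / 2) := latticeConst_nonneg _ hκ
  have hCc : (0 : ℝ) ≤ curl1C (d + 1) L / (1 - thetaLoc (d + 1) L * ε) := div_nonneg (curl1C_nonneg (d + 1) L) (by linarith only [hθl])
  exact line_core (βp := 4 * (Real.exp β - 1)) (ε := ε) (t := r + 4 * (Real.exp β - 1) + ε) (T := δ + 4 * (Real.exp β - 1) + ε)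
    hMr.symm hK hM1 (Real.exp_pos (-(c * ℓ))).le (Nat.cast_nonneg (Fintype.card n)) hCg hCd
    hD hlc (Real.exp_pos (-(kappa163 (d + 1) / (d + 1) / 2 * ℓ))).le hCc hKd hcP hK3 hK4
    hlq hr0 hC₀ ha₀ rfl ht0 htT hMa₀ hMa₁ hBa hBb hθ hc₀

end

end Summit.QuantumFields.BalabanUV.T4Continuum.NE7TorusRoadLine
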